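import Literature.MathematicalPhysics.QuantumFieldTheory.PointwiseOSReconstruction

/-!
# `InversionUpgradeNormalised` (item stmt-CriticalPhenomena-1982): reflection positivity forces every even order to be non-zero

Negative knowledge about the crux
`Summit.CriticalPhenomena.Ising3DConformalLimit.Theses.HyperoctahedralRP.InversionUpgradeNormalised`
(standing crux disprover, cycle 2, D-0016) — a constraint on the OPEN negative question "is there
a reflection-positive decoy in the Ising window?" (`Cruxes/InversionUpgradeNormalised/Disproof.lean`,
§7 `rpDecoyInWindow`), and a uniform explanation of why the model-blind no-go witnesses
(`ScaleNotMoebius.narrowFamily`: `S₆ ≡ 0`; `sixFamily`: `S₈ ≡ 0`) are not OS-positive.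

General pointwise-OS folklore, in any dimension `d` and along any axis `τ`, in the language of
`Literature.MathematicalPhysics.QuantumFieldTheory.PointwiseOSReconstruction`:

* `osPointKernel_eq_zero_of_self_eq_zero` — OS Cauchy–Schwarz: a vanishing diagonal Gram entry
  `K(a,a) = 0` kills the row, `K(a,b) = 0` for all `b` (reflection positivity + symmetric kernel);
* `corr_eq_of_range_eq` — permutation symmetry: `S` depends only on the set of (distinct) points;
* `osPointKernel_self_eq_zero_down` — the DOWNWARD STEP: if the rows of all `(k+1)`-point
  half-space configurations with pairwise distinct heights vanish, so do the diagonal entries of all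
  `k`-point configurations with distinct heights (`k ≥ 1`): translate `θa ⊔ a` down along `e_τ`
  until exactly the lowest point of `a` has crossed the mirror — the result is `θP ⊔ Q` with
  `|P| = k+1`, `|Q| = k-1`;
* `even_order_ne_zero_of_reflectionPositive` — **THEOREM**: OS positivity along `τ` + reflection
  invariance + permutation symmetry + translation invariance + non-degenerate `S₂` ⇒ for every
  `k ≥ 1`, `S_{2k} ≢ 0` on `NonCoincident`. So every reflection-positive candidate decoy has ALL even
  orders non-zero: no truncated family (finitely many non-zero orders, e.g. a finite-order
  perturbation of a generalized free field) can be OS-positive.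

Theorem-only file.
-/

noncomputable section

namespace Summit.CriticalPhenomena.Ising3DConformalLimit.InversionUpgradeNormalisedNegative

open Literature.Probability.LatticeModels Literature.MathematicalPhysics.QuantumFieldTheory
open Set Function

variable {d : ℕ} {τ : Fin d}

/-- **OS Cauchy–Schwarz.** Under reflection positivity (with a symmetric OS kernel), a vanishing
diagonal entry `K(a,a) = 0` kills the whole row: `K(a,b) = 0` for every `b`. [cite: GlimmJaffe1987, §6.1 Prop. 6.1.1] -/
theorem osPointKernel_eq_zero_of_self_eq_zero {S : CorrFamily d} (hRP : IsReflectionPositiveAlong τ S)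
    (hR : IsReflectionInvariantAlong τ S) (hP : IsPermutationSymmetric S)
    {a : HalfSpaceConfig d τ} (ha : osPointKernel S a a = 0) (b : HalfSpaceConfig d τ) :
    osPointKernel S a b = 0 := by
  by_contra hs
  set s := osPointKernel S a b with hs_def
  set t := osPointKernel S b b with ht_def
  have hba : osPointKernel S b a = s := (osPointKernel_comm hR hP b a).trans rfl
  have key := hRP 2 ![a, b] ![-(t + 1) / (2 * s), 1]
  simp only [Fin.sum_univ_two, Matrix.cons_val_zero, Matrix.cons_val_one] at key
  rw [ha, hba, ← hs_def, ← ht_def] at key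
  have h1 : -(t + 1) / (2 * s) * 1 * s = -(t + 1) / 2 := by field_simp
  have h2 : 1 * (-(t + 1) / (2 * s)) * s = -(t + 1) / 2 := by field_simp
  rw [mul_zero, h1, h2] at key
  linarith

/-- Permutation symmetry: `S` depends only on the SET of (distinct) points. [folklore] -/
theorem corr_eq_of_range_eq {S : CorrFamily d} (hP : IsPermutationSymmetric S) {n n' : ℕ}
    {x : Fin n → EuclideanSpace ℝ (Fin d)} {x' : Fin n' → EuclideanSpace ℝ (Fin d)}
    (hx : Injective x) (hx' : Injective x') (h : Set.range x = Set.range x') : S n x = S n' x' := by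
  let e : Fin n' ≃ Fin n :=
    (Equiv.ofInjective x' hx').trans ((Equiv.setCongr h.symm).trans (Equiv.ofInjective x hx).symm)
  have he : ∀ j, x (e j) = x' j := by
    intro j
    show x ((Equiv.ofInjective x hx).symm ((Equiv.setCongr h.symm) (Equiv.ofInjective x' hx' j))) = x' j
    rw [Equiv.apply_ofInjective_symm hx]
    rfl
  calc S n x = S n' (x ∘ e) := (hP.comp_equiv e x).symm
    _ = S n' x' := by
        congr 1
        funext j
        exact he j

/-- `θ_τ (p + t e_τ) = θ_τ p - t e_τ`. [folklore] -/
theorem axisReflection_add_single (p : EuclideanSpace ℝ (Fin d)) (t : ℝ) :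
    axisReflection τ (p + EuclideanSpace.single τ t) = axisReflection τ p - EuclideanSpace.single τ t := by
  ext i
  simp only [axisReflection_apply, PiLp.add_apply, PiLp.sub_apply, PiLp.single_apply]
  split_ifs with h
  · simp [h]; ring
  · simp

/-- `θ_τ (θ_τ p + t e_τ) = p - t e_τ`. [folklore] -/
theorem axisReflection_axisReflection_add_single (p : EuclideanSpace ℝ (Fin d)) (t : ℝ) :
    axisReflection τ (axisReflection τ p + EuclideanSpace.single τ t) = p - EuclideanSpace.single τ t := by
  rw [axisReflection_add_single, axisReflection_axisReflection]

/-- **DOWNWARD STEP.** If the OS rows of all `(k+1)`-point half-space configurations with pairwise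
distinct heights vanish, then the OS diagonal entries of all `k`-point configurations with
distinct heights vanish (`k ≥ 1`): translate `θa' ⊔ a'` down along `e_τ` until exactly the lowest
point of `a'` has crossed the mirror; the result is `θP ⊔ Q` with `|P| = k+1`, `|Q| = k-1`.
[folklore] -/
theorem osPointKernel_self_eq_zero_down {S : CorrFamily d} (hP : IsPermutationSymmetric S)
    (hT : IsTranslationInvariant S) {k : ℕ}
    (hrow : ∀ a : HalfSpaceConfig d τ, a.n = k + 1 → Injective (fun i => a.pts i τ) →
      ∀ b : HalfSpaceConfig d τ, osPointKernel S a b = 0)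
    (a' : HalfSpaceConfig d τ) (hk : a'.n = k) (hk1 : 1 ≤ k) (hinj : Injective (fun i => a'.pts i τ)) :
    osPointKernel S a' a' = 0 := by
  obtain ⟨n, p, hpinj, hpos⟩ := a'
  simp only at hk hinj
  subst hk
  obtain ⟨m, rfl⟩ : ∃ m, n = m + 1 := ⟨n - 1, by omega⟩
  -- the lowest point `i₀` and a level `T` strictly between it and the others
  obtain ⟨i₀, -, hi₀⟩ := Finset.exists_min_image Finset.univ (fun i => p i τ) Finset.univ_nonempty
  have hlt : ∀ j, j ≠ i₀ → p i₀ τ < p j τ := fun j hj =>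
    lt_of_le_of_ne (hi₀ j (Finset.mem_univ j)) fun h => hj (hinj h).symm
  obtain ⟨T, hT1, hT2⟩ : ∃ T, p i₀ τ < T ∧ ∀ j, j ≠ i₀ → T ≤ p j τ := by
    by_cases hne : (Finset.univ.erase i₀).Nonempty
    · refine ⟨(Finset.univ.erase i₀).inf' hne (fun i => p i τ), ?_, fun j hj => ?_⟩
      · obtain ⟨j, hj, hjeq⟩ := Finset.exists_mem_eq_inf' hne (fun i => p i τ)
        rw [hjeq]
        exact hlt j (Finset.ne_of_mem_erase hj)
      · exact Finset.inf'_le _ (Finset.mem_erase.2 ⟨hj, Finset.mem_univ j⟩)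
    · refine ⟨p i₀ τ + 1, by linarith, fun j hj => ?_⟩
      exact absurd ⟨j, Finset.mem_erase.2 ⟨hj, Finset.mem_univ j⟩⟩ hne
  set t : ℝ := (p i₀ τ + T) / 2 with ht_def
  have ht1 : p i₀ τ < t := by rw [ht_def]; linarith
  have ht2 : ∀ j, j ≠ i₀ → t < p j τ := fun j hj => by
    have := hT2 j hj; rw [ht_def]; linarith
  set v : EuclideanSpace ℝ (Fin d) := EuclideanSpace.single τ t with hv_def
  have hvτ : v τ = t := by simp [hv_def]
  -- the new configurations
  let P : HalfSpaceConfig d τ :=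
    { n := (m + 1) + 1
      pts := Fin.append (fun i => p i + v) (fun _ : Fin 1 => axisReflection τ (p i₀) + v)
      injective := by
        rw [Fin.append_injective_iff]
        refine ⟨(add_left_injective v).comp hpinj, Function.injective_of_subsingleton _, fun i j h => ?_⟩
        have h1 := congrArg (fun z : EuclideanSpace ℝ (Fin d) => z τ) h
        simp only [PiLp.add_apply, axisReflection_apply, if_true] at h1
        linarith [hpos i, hpos i₀]
      pos := by
        intro i
        refine Fin.addCases (fun j => ?_) (fun j => ?_) i
        · simp only [Fin.append_left, PiLp.add_apply, hvτ]
          linarith [hpos j, hpos i₀, ht1]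
        · simp only [Fin.append_right, PiLp.add_apply, axisReflection_apply, if_true, hvτ]
          linarith }
  let Q : HalfSpaceConfig d τ :=
    { n := m
      pts := fun j => p (i₀.succAbove j) - v
      injective := fun j j' h => Fin.succAbove_right_injective (hpinj (sub_left_injective h))
      pos := fun j => by
        simp only [PiLp.sub_apply, hvτ]
        linarith [ht2 _ (Fin.succAbove_ne i₀ j)] }
  have hPinj : Injective (fun i => P.pts i τ) := by
    intro i j h
    revert h
    refine Fin.addCases (fun i' => ?_) (fun i' => ?_) i <;>
      refine Fin.addCases (fun j' => ?_) (fun j' => ?_) j <;> intro h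
    · simp only [P, Fin.append_left, PiLp.add_apply, hvτ, add_left_inj] at h
      rw [hinj h]
    · simp only [P, Fin.append_left, Fin.append_right, PiLp.add_apply, axisReflection_apply, if_true,
        hvτ] at h
      linarith [hpos i', hpos i₀]
    · simp only [P, Fin.append_left, Fin.append_right, PiLp.add_apply, axisReflection_apply, if_true,
        hvτ] at h
      linarith [hpos j', hpos i₀]
    · rw [Subsingleton.elim i' j']
  have hzero := hrow P rfl hPinj Q
  -- compare `K(a', a')` with `K(P, Q)`: same set of points after translating by `-v`
  have hx : Injective (Fin.append (fun i => axisReflection τ (p i)) p) :=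
    osPointKernel_arg_injective ⟨m + 1, p, hpinj, hpos⟩ ⟨m + 1, p, hpinj, hpos⟩
  have hy : Injective (fun i => Fin.append (fun i => axisReflection τ (p i)) p i + (-v)) :=
    (add_left_injective (-v)).comp hx
  have hz : Injective (Fin.append (fun i => axisReflection τ (P.pts i)) Q.pts) :=
    osPointKernel_arg_injective P Q
  have hθv : ∀ q : EuclideanSpace ℝ (Fin d), axisReflection τ (q + v) = axisReflection τ q - v :=
    fun q => by rw [hv_def]; exact axisReflection_add_single q t
  have hθθv : ∀ q : EuclideanSpace ℝ (Fin d), axisReflection τ (axisReflection τ q + v) = q - v :=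
    fun q => by rw [hv_def]; exact axisReflection_axisReflection_add_single q t
  have hrange : Set.range (fun i => Fin.append (fun i => axisReflection τ (p i)) p i + (-v)) =
      Set.range (Fin.append (fun i => axisReflection τ (P.pts i)) Q.pts) := by
    -- membership in the range of an `append`
    have mem_append : ∀ {α : Type} {a b : ℕ} (f : Fin a → α) (g : Fin b → α) (y : α),
        y ∈ Set.range (Fin.append f g) ↔ (∃ i, f i = y) ∨ ∃ j, g j = y := by
      intro α a b f g y
      constructor
      · rintro ⟨i, rfl⟩
        refine Fin.addCases (fun j => ?_) (fun j => ?_) i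
        · exact Or.inl ⟨j, (Fin.append_left f g j).symm⟩
        · exact Or.inr ⟨j, (Fin.append_right f g j).symm⟩
      · rintro (⟨j, rfl⟩ | ⟨j, rfl⟩)
        · exact ⟨Fin.castAdd b j, Fin.append_left f g j⟩
        · exact ⟨Fin.natAdd a j, Fin.append_right f g j⟩
    ext y
    rw [Set.mem_range, mem_append]
    constructor
    · rintro ⟨i, rfl⟩
      refine Fin.addCases (fun j => ?_) (fun j => ?_) i
      · -- reflected point of `a'`, shifted: comes from the first block of `P`
        refine Or.inl ⟨Fin.castAdd 1 j, ?_⟩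
        simp only [P, Fin.append_left, hθv, sub_eq_add_neg]
      · -- point `p j - v`: either `j = i₀` (reflected extra point of `P`) or in `Q`
        by_cases hj : j = i₀
        · subst hj
          refine Or.inl ⟨Fin.natAdd (m + 1) 0, ?_⟩
          simp only [P, Fin.append_right, hθθv, sub_eq_add_neg]
        · obtain ⟨z, hz⟩ := Fin.exists_succAbove_eq hj
          refine Or.inr ⟨z, ?_⟩
          simp only [Q, hz, Fin.append_right, sub_eq_add_neg]
    · rintro (⟨i, rfl⟩ | ⟨j, rfl⟩)
      · refine Fin.addCases (fun j => ?_) (fun j => ?_) i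
        · refine ⟨Fin.castAdd (m + 1) j, ?_⟩
          simp only [P, Fin.append_left, hθv, sub_eq_add_neg]
        · refine ⟨Fin.natAdd (m + 1) i₀, ?_⟩
          simp only [P, Fin.append_right, hθθv, sub_eq_add_neg]
      · refine ⟨Fin.natAdd (m + 1) (i₀.succAbove j), ?_⟩
        simp only [Q, Fin.append_right, sub_eq_add_neg]
  calc osPointKernel S ⟨m + 1, p, hpinj, hpos⟩ ⟨m + 1, p, hpinj, hpos⟩
      = S ((m + 1) + (m + 1)) (fun i => Fin.append (fun i => axisReflection τ (p i)) p i + (-v)) :=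
        (hT _ (-v) _).symm
    _ = S (P.n + Q.n) (Fin.append (fun i => axisReflection τ (P.pts i)) Q.pts) :=
        corr_eq_of_range_eq hP hy hz hrange
    _ = 0 := hzero

/-- **Reflection positivity forces every even order to be non-zero.** If `S` is OS-positive along
`τ`, reflection invariant, permutation symmetric, translation invariant and has a non-degenerate
two-point function, then for every `k ≥ 1` the `2k`-point function does not vanish identically on
non-coincident configurations (indeed some OS diagonal entry `S_{2k}(θa ⊔ a)` is non-zero). In
particular NO family with finitely many non-zero orders (`narrowFamily`, `sixFamily`, any truncated
perturbation of a Gaussian) is reflection positive. [folklore] -/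
theorem even_order_ne_zero_of_reflectionPositive {S : CorrFamily d} (hRP : IsReflectionPositiveAlong τ S)
    (hR : IsReflectionInvariantAlong τ S) (hP : IsPermutationSymmetric S) (hT : IsTranslationInvariant S)
    (hnd : IsNondegenerateTwoPoint S) (k : ℕ) (hk : 1 ≤ k) :
    ¬ ∀ x ∈ NonCoincident d (k + k), S (k + k) x = 0 := by
  intro hzero
  -- rows of `k`-point configurations vanish
  have hrowk : ∀ a : HalfSpaceConfig d τ, a.n = k → Injective (fun i => a.pts i τ) →
      ∀ b : HalfSpaceConfig d τ, osPointKernel S a b = 0 := by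
    intro a hak _ b
    refine osPointKernel_eq_zero_of_self_eq_zero hRP hR hP ?_ b
    obtain ⟨n, p, hp, hpos⟩ := a
    simp only at hak
    subst hak
    exact hzero _ (osPointKernel_arg_injective ⟨n, p, hp, hpos⟩ ⟨n, p, hp, hpos⟩)
  -- descend to `k = 1`
  have hdesc : ∀ e j, 1 ≤ j → j + e = k → ∀ a : HalfSpaceConfig d τ, a.n = j →
      Injective (fun i => a.pts i τ) → ∀ b : HalfSpaceConfig d τ, osPointKernel S a b = 0 := by
    intro e
    induction e with
    | zero =>
      intro j _ hjk
      have : j = k := by omega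
      subst this
      exact hrowk
    | succ e ih =>
      intro j hj1 hjk a haj hainj b
      have hrow' := ih (j + 1) (by omega) (by omega)
      exact osPointKernel_eq_zero_of_self_eq_zero hRP hR hP
        (osPointKernel_self_eq_zero_down hP hT hrow' a haj hj1 hainj) b
  have h1 := hdesc (k - 1) 1 le_rfl (by omega)
  -- contradiction with non-degeneracy at `(θ e_τ, e_τ)`
  let a : HalfSpaceConfig d τ :=
    { n := 1
      pts := fun _ => EuclideanSpace.single τ 1
      injective := Function.injective_of_subsingleton _
      pos := fun _ => by simp }
  have hK := h1 a rfl (Function.injective_of_subsingleton _) a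
  have hpos : 0 < osPointKernel S a a := hnd _ (osPointKernel_arg_injective a a)
  exact hpos.ne' hK


/-- The same with `2 * k`. [folklore] -/
theorem two_mul_order_ne_zero_of_reflectionPositive {S : CorrFamily d} (hRP : IsReflectionPositiveAlong τ S)
    (hR : IsReflectionInvariantAlong τ S) (hP : IsPermutationSymmetric S) (hT : IsTranslationInvariant S)
    (hnd : IsNondegenerateTwoPoint S) (k : ℕ) (hk : 1 ≤ k) :
    ¬ ∀ x ∈ NonCoincident d (2 * k), S (2 * k) x = 0 := by
  have h := even_order_ne_zero_of_reflectionPositive hRP hR hP hT hnd k hk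
  rwa [← two_mul] at h

/-- Corollary in the shape of the OS premises bundle: a family admitting the pointwise OS
reconstruction along some axis and having a non-degenerate two-point function has all even orders
non-zero; contrapositively, a family with SOME identically vanishing even order `2k ≥ 2` (on
non-coincident configurations) admits no pointwise OS reconstruction along any axis. [folklore] -/
theorem not_pointwiseOSReconstruction_of_even_order_eq_zero {S : CorrFamily d}
    (hnd : IsNondegenerateTwoPoint S) {k : ℕ} (hk : 1 ≤ k)
    (hzero : ∀ x ∈ NonCoincident d (k + k), S (k + k) x = 0) (τ : Fin d) :
    ¬ PointwiseOSReconstruction τ S := fun h =>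
  even_order_ne_zero_of_reflectionPositive h.reflectionPositive h.reflectionInvariant h.symmetric
    h.translationInvariant hnd k hk hzero

end Summit.CriticalPhenomena.Ising3DConformalLimit.InversionUpgradeNormalisedNegative

end
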